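import Summits.ResolutionOfSingularities.ResolutionOfSingularities.Theorems.EquisingularLiftEquisingularLiftNatSpecimenQuarticPointStep
import Summits.ResolutionOfSingularities.ResolutionOfSingularities.Theorems.EquisingularLiftEquisingularLiftNatSpecimenQuarticSingularLocus
import Summits.ResolutionOfSingularities.ResolutionOfSingularities.Theorems.EquisingularLiftEquisingularLiftNatSpecimenQuarticTangentLine
import Literature.AlgebraicGeometry.Resolution.AlterationsNormalFormBlowupFormalProofs
import Literature.AlgebraicGeometry.Resolution.NormalCrossingsLocal
import Literature.AlgebraicGeometry.Resolution.ProjectiveSpaceRegular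
import Literature.AlgebraicGeometry.Resolution.IdealSheafLemmas
import Literature.AlgebraicGeometry.Resolution.BlowupsLocal
import Literature.AlgebraicGeometry.Motives.ProjBasicOpenSubscheme
import HarnessLib

/-!
# [OURS · L1 W4.5(b) · EL♮(3)] SPECIMEN-Q DOWNSTAIRS, part R1a — CHART ALGEBRA for the local two-step regularity of the quartic
# `H = V(x₀²x₃² + x₁⁴ + x₂⁴)` at a singular point (crux `EquisingularLiftNatThree` = stmt-ResolutionOfSingularities-20148, line
# `sections3`; res-L1-w45b-lead-2 CUT 2026-08-27T08:41:07Z «SPECIMEN-Q DOWNSTAIRS» to res-D-pv-034 AS res-L1-s36-pv-3; helper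
# `--supports … --as helper`, closes nothing)

HONEST FRAMING. OURS (cell `res-hironaka`, chain w45b, slot W4.5(b)); NOT a statement of any manuscript; AI-written, weaker
than expert review. Plumbing over res-L1-w45b-stub-4's ring-level T-ISO-1 layer (`…SpecimenQuarticPointStep` p511135,
`…SpecimenQuarticLineStep` p510354, `…SpecimenQuarticSingularLocus` p515467, `…SpecimenQuarticTangentLine` p516267).

CONTENT. `D₀ = k[x,y,z]/(z² + x⁴ + y⁴)` (the affine chart `x₀ = 1` of the quartic), its singular point `𝔪̄₀ = (x̄, ȳ, z̄)` (maximal,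
`isMaximal_mbar`; the closed point `pt` of `Spec D₀`); the Stacks-0804 chart rings `D₀[𝔪̄₀/x̄ⱼ]` (`Bch`) with exceptional generator
`x̄ⱼ/1` (`exc`): `preimage_pt_eq_zeroLocus` (the preimage of the point in the chart is `V(x̄ⱼ/1)`), `comap_vanishingIdeal_exceptional`
(the ideal sheaf of the REDUCED exceptional set `ρ₁⁻¹{𝔪̄₀}` of any blow-up `ρ₁` pulls back to `√(x̄ⱼ/1)~` along an open chart
over `Spec D₀`; Mathlib `vanishingIdeal_ideal` + `comap_vanishingIdeal_of_isOpenImmersion`); on the `z̄`-chart `z̄/1` is a UNIT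
(`0 = f = z̄²(1 + z̄²((x/z)⁴ + (y/z)⁴))`, `isUnit_exc_two`) so `√(z̄/1) = (1)`; on the `x̄`/`ȳ`-charts stub-4's presentations
`k[y]/(y₂² + y₁²(1 + y₀⁴)) ≅ D₀[𝔪̄₀/x̄ⱼ]` rebuilt with the exceptional generator TRACKED (`exists_pointChartⱼ_equiv_track`: `ε(ȳ₁) = x̄ⱼ/1`,
res-L1-w45b-stub-4's recipe of 2026-08-27T09:21:07Z), under which `√(x̄ⱼ/1) = ε(ȳ₁, ȳ₂)` (`radical_span_exc_eq_of_equiv`, via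
`radical_span_X_one_g`). Consumer: `…SpecimenQuarticTcDeltaLocalTwoStep.isRegular_twoStep`.

References: The Stacks Project, Tags 0804, 052Q; Görtz–Wedhorn I (13.19), Prop. 13.96 (2); Hartshorne II Ex. 3.2.6.
-/

set_option linter.dupNamespace false

noncomputable section

open CategoryTheory CategoryTheory.Limits AlgebraicGeometry TopologicalSpace
open MvPolynomial
open Literature.AlgebraicGeometry.Resolution
open AlgebraicGeometry.Scheme.IdealSheafData
open Summit.ResolutionOfSingularities.ResolutionOfSingularities.Theorems.EquisingularLift

namespace Summit.ResolutionOfSingularities.ResolutionOfSingularities.Cruxes.EquisingularLiftNat.Sections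

namespace SpecimenQuarticTcDelta

universe u

variable (k : Type) [Field k]

/-! ## The affine singular chart `D₀ = k[x,y,z]/(z² + x⁴ + y⁴)` and its singular point -/

/-- The chart polynomial `f = z² + x⁴ + y⁴` (stub-4's `fSing`, written literally). [folklore] -/
abbrev fQ : MvPolynomial (Fin 3) k := X 2 ^ 2 + X 0 ^ 4 + X 1 ^ 4

/-- The chart ring `D₀ = k[x,y,z]/(f)`. [folklore] -/
abbrev D₀ : Type := MvPolynomial (Fin 3) k ⧸ Ideal.span {fQ k}

/-- The maximal ideal `𝔪̄₀ = (x̄, ȳ, z̄) ⊂ D₀` of the singular point. [folklore] -/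
abbrev mbar : Ideal (D₀ k) := (PointBlowup.originIdeal 2 k).map (Ideal.Quotient.mk (Ideal.span {fQ k}))

/-- The generators `x̄, ȳ, z̄` of `𝔪̄₀`. [folklore] -/
def gbar : Fin 3 → D₀ k := fun i => Ideal.Quotient.mk (Ideal.span {fQ k}) (X i)

/-- `(x̄, ȳ, z̄) = 𝔪̄₀`. [folklore] -/
theorem span_range_gbar : Ideal.span (Set.range (gbar k)) = mbar k := by
  rw [mbar, PointBlowup.originIdeal, Ideal.map_span, ← Set.range_comp]
  rfl

/-- `f ∈ 𝔪₀`. [folklore] -/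
theorem fQ_mem_originIdeal : fQ k ∈ PointBlowup.originIdeal 2 k := by
  have h := SpecimenQuartic.f_mem_sq_of_forall_X_mem k (PointBlowup.originIdeal 2 k)
    (fun i => Ideal.subset_span (Set.mem_range_self i))
  exact Ideal.pow_le_self two_ne_zero h

/-- `𝔪₀ = ker (eval 0)`: a polynomial vanishing at the origin has no constant term. [folklore] -/
theorem originIdeal_eq_ker_eval :
    PointBlowup.originIdeal 2 k = RingHom.ker (MvPolynomial.eval (0 : Fin 3 → k)) := by
  apply le_antisymm
  · rw [PointBlowup.originIdeal, Ideal.span_le]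
    rintro _ ⟨i, rfl⟩
    simp [RingHom.mem_ker]
  · intro p hp
    rw [RingHom.mem_ker, MvPolynomial.eval_zero] at hp
    rw [PointBlowup.originIdeal, ← Set.image_univ, MvPolynomial.mem_ideal_span_X_image]
    intro m hm
    by_contra! hcon
    have hm0 : m = 0 := by
      ext i
      simpa using hcon i (Set.mem_univ i)
    subst hm0
    rw [MvPolynomial.mem_support_iff] at hm
    exact hm (by simpa [MvPolynomial.constantCoeff_eq] using hp)

/-- `𝔪₀ ⊂ k[x,y,z]` is maximal. [folklore] -/
theorem isMaximal_originIdeal : (PointBlowup.originIdeal 2 k).IsMaximal := by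
  rw [originIdeal_eq_ker_eval]
  exact RingHom.ker_isMaximal_of_surjective (MvPolynomial.eval (0 : Fin 3 → k)) fun a => ⟨C a, by simp⟩

/-- `𝔪̄₀ ⊂ D₀` is maximal. [folklore] -/
theorem isMaximal_mbar : (mbar k).IsMaximal := by
  have hsurj : Function.Surjective (Ideal.Quotient.mk (Ideal.span {fQ k})) := Ideal.Quotient.mk_surjective
  rcases Ideal.map_eq_top_or_isMaximal_of_surjective _ hsurj (isMaximal_originIdeal k) with h | h
  · exfalso
    have hc := congrArg (Ideal.comap (Ideal.Quotient.mk (Ideal.span {fQ k}))) h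
    rw [Ideal.comap_map_of_surjective _ hsurj, Ideal.comap_top] at hc
    have hker : Ideal.comap (Ideal.Quotient.mk (Ideal.span {fQ k})) ⊥ ≤ PointBlowup.originIdeal 2 k := by
      rw [← RingHom.ker_eq_comap_bot, Ideal.mk_ker, Ideal.span_le, Set.singleton_subset_iff]
      exact fQ_mem_originIdeal k
    have : PointBlowup.originIdeal 2 k = ⊤ := by
      rw [← hc]; exact (sup_eq_left.mpr hker).symm
    exact (isMaximal_originIdeal k).ne_top this
  · exact h

/-- The singular point `𝔪̄₀` as a point of `Spec D₀`. [folklore] -/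
def pt : Spec (.of (D₀ k)) := ⟨mbar k, (isMaximal_mbar k).isPrime⟩

/-- The singular point is closed. [folklore] -/
theorem isClosed_pt : IsClosed ({pt k} : Set (Spec (.of (D₀ k)))) :=
  (PrimeSpectrum.isClosed_singleton_iff_isMaximal _).mpr (isMaximal_mbar k)

/-! ## The reduced structure of a zero locus on an affine scheme -/

/-- **The vanishing ideal sheaf of `V(s) ⊆ Spec R` is `√(s)~`.** [cite: Hartshorne1977, II Example 3.2.6] -/
theorem vanishingIdeal_zeroLocus_Spec (R : CommRingCat.{u}) (s : Set R) :
    vanishingIdeal (⟨PrimeSpectrum.zeroLocus s, PrimeSpectrum.isClosed_zeroLocus s⟩ : Closeds (Spec R)) =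
      ofIdealTop (((Ideal.span s).radical).map (Scheme.ΓSpecIso R).inv.hom) := by
  apply Scheme.IdealSheafData.ext_of_isAffine
  rw [ideal_ofIdealTop_top, vanishingIdeal_ideal]
  have hfS : (⟨⊤, isAffineOpen_top (Spec R)⟩ : (Spec R).affineOpens).2.fromSpec = Spec.map (Scheme.ΓSpecIso R).inv :=
    (IsAffineOpen.fromSpec_top (X := Spec R)).trans (Scheme.isoSpec_Spec_inv R)
  change PrimeSpectrum.vanishingIdeal ((⟨⊤, isAffineOpen_top (Spec R)⟩ : (Spec R).affineOpens).2.fromSpec ⁻¹'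
    PrimeSpectrum.zeroLocus s) = _
  have h := Literature.AlgebraicGeometry.Motives.ProjSubscheme.vanishingIdeal_preimage_SpecMap_of_iso
    (Scheme.ΓSpecIso R).symm (PrimeSpectrum.zeroLocus s)
  rw [Iso.symm_hom] at h
  rw [hfS, h, ← PrimeSpectrum.zeroLocus_span s, PrimeSpectrum.vanishingIdeal_zeroLocus_eq_radical]


/-! ## The Stacks-0804 charts of a blow-up of `Spec D₀` at `𝔪̄₀` and the exceptional locus on them -/

/-- The chart ring `D₀[𝔪̄₀/x̄ⱼ]` at the generator `x̄ⱼ` (stub-4's point-step chart rings). [cite: StacksProject, Tag 0804] -/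
abbrev Bch (j : Fin 3) : Type := blowupAlgebra (mbar k) (gbar k j)

/-- The exceptional generator `x̄ⱼ/1 ∈ D₀[𝔪̄₀/x̄ⱼ]`. [cite: StacksProject, Tag 052Q] -/
abbrev exc (j : Fin 3) : Bch k j := algebraMap (D₀ k) (Bch k j) (gbar k j)

/-- `x̄ᵢ ∈ 𝔪̄₀`. [folklore] -/
theorem gbar_mem (i : Fin 3) : gbar k i ∈ mbar k := by
  rw [← span_range_gbar]; exact Ideal.subset_span (Set.mem_range_self i)

/-- The fraction `x̄ᵢ/x̄ⱼ ∈ D₀[𝔪̄₀/x̄ⱼ]`. [cite: StacksProject, Tag 052Q] -/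
abbrev fr (j i : Fin 3) : Bch k j := blowupAlgebra.gen (mbar k) (gbar k j) (gbar k i) (gbar_mem k i)

/-- `x̄ᵢ = x̄ⱼ · (x̄ᵢ/x̄ⱼ)` in the chart ring. [cite: StacksProject, Tag 052Q] -/
theorem algebraMap_gbar_eq (j i : Fin 3) :
    algebraMap (D₀ k) (Bch k j) (gbar k i) = exc k j * fr k j i :=
  (blowupAlgebra.algebraMap_mul_gen (mbar k) (gbar k j) (gbar k i) (gbar_mem k i)).symm

/-- `𝔪̄₀ · D₀[𝔪̄₀/x̄ⱼ] = (x̄ⱼ)`. [cite: StacksProject, Tag 052Q] -/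
theorem map_mbar_eq_span (j : Fin 3) :
    (mbar k).map (algebraMap (D₀ k) (Bch k j)) = Ideal.span {exc k j} :=
  map_blowupAlgebra_eq_span (gbar_mem k j)

/-- **The preimage of the singular point in the chart is the exceptional divisor `V(x̄ⱼ/1)`.** [cite: StacksProject, Tag 0804] -/
theorem preimage_pt_eq_zeroLocus (j : Fin 3) :
    (Spec.map (CommRingCat.ofHom (algebraMap (D₀ k) (Bch k j)))) ⁻¹' {pt k} =
      PrimeSpectrum.zeroLocus {exc k j} := by
  ext q
  have key : mbar k ≤ q.asIdeal.comap (algebraMap (D₀ k) (Bch k j)) ↔ exc k j ∈ q.asIdeal := by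
    rw [← Ideal.map_le_iff_le_comap, map_mbar_eq_span, Ideal.span_le, Set.singleton_subset_iff, SetLike.mem_coe]
  constructor
  · intro hq
    have hq' : PrimeSpectrum.comap (algebraMap (D₀ k) (Bch k j)) q = pt k := hq
    have hle : mbar k ≤ q.asIdeal.comap (algebraMap (D₀ k) (Bch k j)) := by
      have := congrArg PrimeSpectrum.asIdeal hq'
      rw [PrimeSpectrum.comap_asIdeal] at this
      exact this.symm.le
    exact (PrimeSpectrum.mem_zeroLocus _ _).mpr (Set.singleton_subset_iff.mpr (key.mp hle))
  · intro hq
    have hq' : exc k j ∈ q.asIdeal := Set.singleton_subset_iff.mp ((PrimeSpectrum.mem_zeroLocus _ _).mp hq)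
    show PrimeSpectrum.comap (algebraMap (D₀ k) (Bch k j)) q = pt k
    apply PrimeSpectrum.ext
    rw [PrimeSpectrum.comap_asIdeal]
    exact ((isMaximal_mbar k).eq_of_le (Ideal.IsPrime.ne_top inferInstance) (key.mpr hq')).symm

variable {k}

/-- **The second centre read on a chart**: along an open immersion `φ : Spec D₀[𝔪̄₀/x̄ⱼ] → B₁` over `Spec D₀` the ideal sheaf of the
reduced exceptional set `ρ₁⁻¹{𝔪̄₀}` pulls back to `√(x̄ⱼ/1)~`. [cite: StacksProject, Tag 0804] -/
theorem comap_vanishingIdeal_exceptional {B₁ : Scheme.{0}} {ρ₁ : B₁ ⟶ Spec (.of (D₀ k))} (j : Fin 3)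
    {φ : Spec (.of (Bch k j)) ⟶ B₁} [IsOpenImmersion φ]
    (hφ : φ ≫ ρ₁ = Spec.map (CommRingCat.ofHom (algebraMap (D₀ k) (Bch k j)))) :
    (vanishingIdeal (⟨ρ₁ ⁻¹' {pt k}, (isClosed_pt k).preimage ρ₁.continuous⟩ : Closeds B₁)).comap φ =
      ofIdealTop (((Ideal.span {exc k j}).radical).map (Scheme.ΓSpecIso (.of (Bch k j))).inv.hom) := by
  rw [comap_vanishingIdeal_of_isOpenImmersion, ← vanishingIdeal_zeroLocus_Spec]
  congr 1
  apply Closeds.ext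
  change φ ⁻¹' (ρ₁ ⁻¹' {pt k}) = PrimeSpectrum.zeroLocus {exc k j}
  rw [← Set.preimage_comp, ← TopCat.coe_comp, ← Scheme.Hom.comp_base, hφ]
  exact preimage_pt_eq_zeroLocus k j

variable (k)

/-! ## The `z̄`-chart: the exceptional generator is a unit, the second blow-up is an isomorphism there -/

/-- `f = 0` in every chart ring: `x̄ⱼ² · G = 0`-type identities start from `algebraMap f̄ = 0`. [folklore] -/
theorem algebraMap_fQ_eq_zero (j : Fin 3) :
    algebraMap (D₀ k) (Bch k j) (Ideal.Quotient.mk (Ideal.span {fQ k}) (fQ k)) = 0 := by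
  rw [Ideal.Quotient.eq_zero_iff_mem.mpr (Ideal.mem_span_singleton_self _), map_zero]

/-- **On the `z̄`-chart the exceptional generator `z̄/1` is a unit**: `0 = f = z̄² (1 + z̄² ((x/z)⁴ + (y/z)⁴))` and `z̄/1` is a
non-zero-divisor. [OURS · T-ISO-1 plumbing; Stacks 052Q] -/
theorem isUnit_exc_two : IsUnit (exc k 2) := by
  set u := fr k 2 0 with hu
  set v := fr k 2 1 with hv
  have h0 := algebraMap_fQ_eq_zero k 2
  have hf : Ideal.Quotient.mk (Ideal.span {fQ k}) (fQ k) = gbar k 2 ^ 2 + gbar k 0 ^ 4 + gbar k 1 ^ 4 := by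
    simp only [fQ, gbar, map_add, map_pow]
  rw [hf, map_add, map_add, map_pow, map_pow, map_pow, algebraMap_gbar_eq k 2 0, algebraMap_gbar_eq k 2 1] at h0
  change exc k 2 ^ 2 + (exc k 2 * u) ^ 4 + (exc k 2 * v) ^ 4 = 0 at h0
  have h1 : exc k 2 ^ 2 * (1 + exc k 2 ^ 2 * (u ^ 4 + v ^ 4)) = 0 := by
    rw [← h0]; ring
  have hnzd : exc k 2 ^ 2 ∈ nonZeroDivisors (Bch k 2) :=
    pow_mem (algebraMap_mem_nonZeroDivisors_blowupAlgebra (I := mbar k) (a := gbar k 2)) 2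
  have h2 : 1 + exc k 2 ^ 2 * (u ^ 4 + v ^ 4) = 0 :=
    (mem_nonZeroDivisors_iff.mp hnzd).1 _ h1
  refine IsUnit.of_mul_eq_one (b := -(exc k 2 * (u ^ 4 + v ^ 4))) ?_
  have : exc k 2 * -(exc k 2 * (u ^ 4 + v ^ 4)) = 1 - (1 + exc k 2 ^ 2 * (u ^ 4 + v ^ 4)) := by ring
  rw [this, h2, sub_zero]

/-- On the `z̄`-chart the pulled-back second centre is the unit ideal sheaf. [folklore] -/
theorem radical_span_exc_two : (Ideal.span {exc k 2}).radical = ⊤ := by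
  rw [Ideal.span_singleton_eq_top.mpr (isUnit_exc_two k), Ideal.radical_top]

/-! ## The `x̄`- and `ȳ`-charts: the second centre is `(ȳ₁, ȳ₂)` of the line-step ring `k[y]/(g)` -/

/-- The line-step polynomial `g = y₂² + y₁² (1 + y₀⁴)` of stub-4's `…SpecimenQuarticLineStep` (written literally). [folklore] -/
abbrev gL : MvPolynomial (Fin 3) k := X 2 ^ 2 + X 1 ^ 2 * (1 + X 0 ^ 4)

/-- The line-step ring `D = k[y₀,y₁,y₂]/(g)`. [folklore] -/
abbrev DL : Type := MvPolynomial (Fin 3) k ⧸ Ideal.span {gL k}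

/-- The line-step centre `(ȳ₁, ȳ₂) ⊂ D`. [folklore] -/
abbrev cenL : Ideal (DL k) := (Ideal.span (Set.range (WhitneyCubic.cen k))).map (Ideal.Quotient.mk (Ideal.span {gL k}))

/-- **`√(ȳ₁) = (ȳ₁, ȳ₂)` in `k[y]/(g)`**: `ȳ₂² = −ȳ₁²(1 + ȳ₀⁴) ∈ (ȳ₁)` and `k[y]/(g, y₁, y₂) ≅ k[y₀]` is reduced. [folklore] -/
theorem radical_span_y1_eq_cenL :
    (Ideal.span {Ideal.Quotient.mk (Ideal.span {gL k}) (X 1)}).radical = cenL k := by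
  set mk := Ideal.Quotient.mk (Ideal.span {gL k}) with hmk
  have hsurj : Function.Surjective mk := Ideal.Quotient.mk_surjective
  -- `(ȳ₁) = ((y₁) + (g)) / (g)` and radicals commute with the quotient map
  have h1 : Ideal.span {mk (X 1)} = (Ideal.span {(X 1 : MvPolynomial (Fin 3) k)} ⊔ Ideal.span {gL k}).map mk := by
    rw [Ideal.map_sup, Ideal.map_span, Set.image_singleton,
      (Ideal.map_eq_bot_iff_le_ker mk).mpr (by rw [Ideal.mk_ker]), sup_bot_eq]
  rw [h1, ← Ideal.map_radical_of_surjective hsurj (by rw [Ideal.mk_ker]; exact le_sup_right)]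
  congr 1
  -- `√(y₁, g) = (y₁, y₂)` in `k[y]` (stub-4 `radical_span_X_one_g`, p516267)
  rw [← SpecimenQuartic.radical_span_X_one_g, Ideal.span_insert]

/-- **The second centre on the `x̄`/`ȳ`-charts through a line-step presentation**: if `ε : k[y]/(g) ≅ D₀[𝔪̄₀/x̄ⱼ]` carries `ȳ₁` to the
exceptional generator `x̄ⱼ/1`, then `√(x̄ⱼ/1) = ε (ȳ₁, ȳ₂) = (ε ȳ₁, ε ȳ₂)`. [folklore] -/
theorem radical_span_exc_eq_of_equiv (j : Fin 3) (ε : DL k ≃+* Bch k j)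
    (hε : ε (Ideal.Quotient.mk (Ideal.span {gL k}) (X 1)) = exc k j) :
    (Ideal.span {exc k j}).radical = (cenL k).map ε.toRingHom := by
  rw [← radical_span_y1_eq_cenL, Ideal.map_radical_of_surjective ε.surjective (by
    rw [(RingHom.injective_iff_ker_eq_bot ε.toRingHom).mp ε.injective]; exact bot_le),
    Ideal.map_span, Set.image_singleton, ← hε]
  rfl


/-! ## The point-step chart isomorphisms with generator tracking (res-L1-w45b-stub-4's recipe, p511135 lineage) -/

/-- **`D ≃+* B₀` with generators tracked** (the `x`-chart of the point step, `nonempty_pointChart₀_equiv` of part II):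
`ε(ȳ₁) = x̄/1` (the exceptional generator `algebraMap (mk (X 0))`), `ε(ȳ₀) = y/x`, `ε(ȳ₂) = z/x` (pinned by
`x̄ · ε(ȳ₀) = ȳ`, `x̄ · ε(ȳ₂) = z̄`; `x̄` is a non-zero-divisor of `B₀`). [OURS · T-ISO-1 algebra] -/
theorem exists_pointChart₀_equiv_track :
    ∃ ε : DL k ≃+* Bch k 0, ε (Ideal.Quotient.mk (Ideal.span {gL k}) (X 1)) = exc k 0 := by
  obtain ⟨θ, hθ0, hθj⟩ := SpecimenQuartic.exists_ringEquiv_pointChart k 0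
  set θ₀ : MvPolynomial (Fin 3) k ≃+* PointBlowup.Chart 2 k 0 :=
    (renameEquiv k (Equiv.swap (0 : Fin 3) 1)).toRingEquiv.trans θ with hθ₀
  have h0 : θ₀ (X 0) = PointBlowup.frac 2 k 0 1 := by
    simp [hθ₀, Equiv.swap_apply_left, hθj 1 (by decide)]
  have h1 : θ₀ (X 1) = PointBlowup.exc 2 k 0 := by
    simp [hθ₀, Equiv.swap_apply_right, hθ0]
  have h2 : θ₀ (X 2) = PointBlowup.frac 2 k 0 2 := by
    simp [hθ₀, Equiv.swap_apply_of_ne_of_ne, hθj 2 (by decide)]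
  set G : MvPolynomial {j : Fin 3 // j ≠ 0} (MvPolynomial (Fin 3) k) :=
    X ⟨2, by decide⟩ ^ 2 + C (X 0 ^ 2) * (1 + X ⟨1, by decide⟩ ^ 4) with hG
  have hev : blowupAlgebra.eval (MvPolynomial.X : Fin 3 → MvPolynomial (Fin 3) k) 0 G =
      PointBlowup.frac 2 k 0 2 ^ 2 + PointBlowup.exc 2 k 0 ^ 2 * (1 + PointBlowup.frac 2 k 0 1 ^ 4) := by
    simp only [hG, map_add, map_pow, map_mul, map_one, blowupAlgebra.eval_X, blowupAlgebra.eval_C]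
  have hθg : θ₀ (X 2 ^ 2 + X 1 ^ 2 * (1 + X 0 ^ 4)) =
      blowupAlgebra.eval (MvPolynomial.X : Fin 3 → MvPolynomial (Fin 3) k) 0 G := by
    rw [hev, map_add, map_pow, h2, map_mul, map_pow, h1, map_add, map_one, map_pow, h0]
  have hf : algebraMap (MvPolynomial (Fin 3) k) (PointBlowup.Chart 2 k 0) (X 2 ^ 2 + X 0 ^ 4 + X 1 ^ 4) =
      algebraMap (MvPolynomial (Fin 3) k) (PointBlowup.Chart 2 k 0) (X 0) ^ 2 *
        blowupAlgebra.eval (MvPolynomial.X : Fin 3 → MvPolynomial (Fin 3) k) 0 G := by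
    rw [hev, map_add, map_add, map_pow, map_pow, map_pow, PointBlowup.algebraMap_X 2 k 0 2,
      PointBlowup.algebraMap_X 2 k 0 1]
    ring
  have hndvd : ¬ algebraMap (MvPolynomial (Fin 3) k) (PointBlowup.Chart 2 k 0) (X 0) ∣
      blowupAlgebra.eval (MvPolynomial.X : Fin 3 → MvPolynomial (Fin 3) k) 0 G := by
    intro h
    have hm := (blowupAlgebra.eval_mem_span_algebraMap_iff (MvPolynomial.X : Fin 3 → MvPolynomial (Fin 3) k) 0
      (SpecimenQuartic.isQuasiRegular_X k) G).mp (Ideal.mem_span_singleton.mpr h) (Finsupp.single ⟨2, by decide⟩ 2)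
    have hc : G.coeff (Finsupp.single ⟨2, by decide⟩ 2) = 1 := by
      classical
      rw [hG, coeff_add, coeff_X_pow, if_pos rfl, coeff_C_mul, coeff_add, coeff_one, coeff_X_pow, if_neg, if_neg]
      · ring
      · intro h0'
        have := congrArg (fun e : {j : Fin 3 // j ≠ 0} →₀ ℕ => e ⟨2, by decide⟩) h0'
        simp at this
      · intro h0'
        have := congrArg (fun e : {j : Fin 3 // j ≠ 0} →₀ ℕ => e ⟨2, by decide⟩) h0'
        simp at this
    rw [hc] at hm
    haveI := SpecimenQuartic.isDomain_quotient_origin k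
    exact ((Ideal.Quotient.isDomain_iff_prime _).mp inferInstance).ne_top ((Ideal.eq_top_iff_one _).mpr hm)
  have hmap : Ideal.map θ₀ (Ideal.span {(X 2 ^ 2 + X 1 ^ 2 * (1 + X 0 ^ 4) : MvPolynomial (Fin 3) k)}) =
      Ideal.span {blowupAlgebra.eval (MvPolynomial.X : Fin 3 → MvPolynomial (Fin 3) k) 0 G} := by
    rw [Ideal.map_span, Set.image_singleton]
    exact congrArg _ (congrArg _ hθg)
  refine ⟨(Ideal.quotientEquiv _ _ θ₀ hmap.symm).trans
    (blowupAlgebra.quotientKerMapQuotientEquiv _ _ hf (SpecimenQuartic.prime_exc k 0) hndvd), ?_⟩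
  · rw [RingEquiv.trans_apply, Ideal.quotientEquiv_mk]
    change blowupAlgebra.mapQuotient _ _ _ (θ₀ (X 1)) = _
    rw [h1]
    exact blowupAlgebra.mapQuotient_algebraMap _ _ _ (X 0)

/-- **`D ≃+* B₁` with generators tracked** (the `y`-chart, `nonempty_pointChart₁_equiv`): `ε(ȳ₁) = ȳ/1`
(`algebraMap (mk (X 1))`), `ȳ · ε(ȳ₀) = x̄`, `ȳ · ε(ȳ₂) = z̄`. [OURS · T-ISO-1 algebra] -/
theorem exists_pointChart₁_equiv_track :
    ∃ ε : DL k ≃+* Bch k 1, ε (Ideal.Quotient.mk (Ideal.span {gL k}) (X 1)) = exc k 1 := by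
  obtain ⟨θ, hθ1, hθj⟩ := SpecimenQuartic.exists_ringEquiv_pointChart k 1
  have h0 : θ (X 0) = PointBlowup.frac 2 k 1 0 := hθj 0 (by decide)
  have h2 : θ (X 2) = PointBlowup.frac 2 k 1 2 := hθj 2 (by decide)
  set G : MvPolynomial {j : Fin 3 // j ≠ 1} (MvPolynomial (Fin 3) k) :=
    X ⟨2, by decide⟩ ^ 2 + C (X 1 ^ 2) * (1 + X ⟨0, by decide⟩ ^ 4) with hG
  have hev : blowupAlgebra.eval (MvPolynomial.X : Fin 3 → MvPolynomial (Fin 3) k) 1 G =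
      PointBlowup.frac 2 k 1 2 ^ 2 + PointBlowup.exc 2 k 1 ^ 2 * (1 + PointBlowup.frac 2 k 1 0 ^ 4) := by
    simp only [hG, map_add, map_pow, map_mul, map_one, blowupAlgebra.eval_X, blowupAlgebra.eval_C]
  have hθg : θ (X 2 ^ 2 + X 1 ^ 2 * (1 + X 0 ^ 4)) =
      blowupAlgebra.eval (MvPolynomial.X : Fin 3 → MvPolynomial (Fin 3) k) 1 G := by
    rw [hev, map_add, map_pow, h2, map_mul, map_pow, hθ1, map_add, map_one, map_pow, h0]
  have hf : algebraMap (MvPolynomial (Fin 3) k) (PointBlowup.Chart 2 k 1) (X 2 ^ 2 + X 0 ^ 4 + X 1 ^ 4) =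
      algebraMap (MvPolynomial (Fin 3) k) (PointBlowup.Chart 2 k 1) (X 1) ^ 2 *
        blowupAlgebra.eval (MvPolynomial.X : Fin 3 → MvPolynomial (Fin 3) k) 1 G := by
    rw [hev, map_add, map_add, map_pow, map_pow, map_pow, PointBlowup.algebraMap_X 2 k 1 2,
      PointBlowup.algebraMap_X 2 k 1 0]
    ring
  have hndvd : ¬ algebraMap (MvPolynomial (Fin 3) k) (PointBlowup.Chart 2 k 1) (X 1) ∣
      blowupAlgebra.eval (MvPolynomial.X : Fin 3 → MvPolynomial (Fin 3) k) 1 G := by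
    intro h
    have hm := (blowupAlgebra.eval_mem_span_algebraMap_iff (MvPolynomial.X : Fin 3 → MvPolynomial (Fin 3) k) 1
      (SpecimenQuartic.isQuasiRegular_X k) G).mp (Ideal.mem_span_singleton.mpr h) (Finsupp.single ⟨2, by decide⟩ 2)
    have hc : G.coeff (Finsupp.single ⟨2, by decide⟩ 2) = 1 := by
      classical
      rw [hG, coeff_add, coeff_X_pow, if_pos rfl, coeff_C_mul, coeff_add, coeff_one, coeff_X_pow, if_neg, if_neg]
      · ring
      · intro h0'
        have := congrArg (fun e : {j : Fin 3 // j ≠ 1} →₀ ℕ => e ⟨2, by decide⟩) h0'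
        simp at this
      · intro h0'
        have := congrArg (fun e : {j : Fin 3 // j ≠ 1} →₀ ℕ => e ⟨2, by decide⟩) h0'
        simp at this
    rw [hc] at hm
    haveI := SpecimenQuartic.isDomain_quotient_origin k
    exact ((Ideal.Quotient.isDomain_iff_prime _).mp inferInstance).ne_top ((Ideal.eq_top_iff_one _).mpr hm)
  have hmap : Ideal.map θ (Ideal.span {(X 2 ^ 2 + X 1 ^ 2 * (1 + X 0 ^ 4) : MvPolynomial (Fin 3) k)}) =
      Ideal.span {blowupAlgebra.eval (MvPolynomial.X : Fin 3 → MvPolynomial (Fin 3) k) 1 G} := by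
    rw [Ideal.map_span, Set.image_singleton]
    exact congrArg _ (congrArg _ hθg)
  refine ⟨(Ideal.quotientEquiv _ _ θ hmap.symm).trans
    (blowupAlgebra.quotientKerMapQuotientEquiv _ _ hf (SpecimenQuartic.prime_exc k 1) hndvd), ?_⟩
  · rw [RingEquiv.trans_apply, Ideal.quotientEquiv_mk]
    change blowupAlgebra.mapQuotient _ _ _ (θ (X 1)) = _
    rw [hθ1]
    exact blowupAlgebra.mapQuotient_algebraMap _ _ _ (X 1)


end SpecimenQuarticTcDelta

end Summit.ResolutionOfSingularities.ResolutionOfSingularities.Cruxes.EquisingularLiftNat.Sections
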